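import Summits.NavierStokesRegularity.NavierStokesRegularity.Theses.PlaneEnergyCeiling
import Summits.NavierStokesRegularity.NavierStokesRegularity.Theses.HardyPointSink
import Summits.NavierStokesRegularity.NavierStokesRegularity.Theorems.PlaneEnergyCeilingPlanarEnergyAPrioriPlanarToHardy
import Summits.NavierStokesRegularity.NavierStokesRegularity.Theorems.PlaneEnergyCeilingPlanarEnergyAPrioriKatoFrame
import HarnessLib

/-!
# Crux `PlanarEnergyAPriori` (stmt-NavierStokesRegularity-16855), route PlaneEnergyCeiling:
  the cross-route edge `PlanarEnergyAPriori ⇒ HardyPointSink.HardyEnergyBound`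

Helper file for the crux item stmt-NavierStokesRegularity-16855
(`Summit.NavierStokesRegularity.NavierStokesRegularity.Theses.PlaneEnergyCeiling.PlanarEnergyAPriori`).

**Main result** (`hardyEnergyBound_of_planarEnergyAPriori`, registered anchor): the planar-energy
ceiling crux of route PlaneEnergyCeiling implies the Hardy-energy crux C2 of route HardyPointSink
(item stmt-NavierStokesRegularity-7979, `Theses.HardyPointSink.HardyEnergyBound`), with the explicit
constant `K = 2πM` and every radius (`r₀ = 1`):

  `PlanarEnergyAPriori → HardyEnergyBound`.

So the two rank-2 cruxes are ORDERED: closing 16855 closes 7979, and every refutation of 7979 (a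
Hardy-unbounded blow-up from a Clay datum, cf. `not_navierStokesRegularity_of_not_hardyEnergyBound`)
refutes 16855 (by `mt`). This is the formal version of the nesting "crux ⇒ GlobalHardyCeiling ⇒ HardyPointSink
C2" recorded in the crux workfiles (`Cruxes/PlanarEnergyAPriori/Ideas/hardy-average-transfer.md`,
STRATEGY-CENSUS gen 1 §A-D7, NEGATIVE-NOTES-ideator2-r1.md).

**Proof.** Given a Kato solution `u` on `[0, T)` from a Clay datum `u₀`, take its classical
Leray–Hopf representative `(U, P)` (`exists_frame_of_isKatoSolutionOn`,
`Theorems/…PlanarEnergyAPrioriKatoFrame.lean`): a frame solution with `U 0 = u₀` and `U t = u t`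
a.e. The crux bounds the planar energies of `U` by `M` on `[0, T)`; the kinematic transfer
(`lintegral_div_enorm_sub_le_of_planar`, `Theorems/…PlanarEnergyAPrioriPlanarToHardy.lean`) turns
this into `∫ |U(t)|²/|x − x₀| ≤ 2πM` for every centre, and the a.e. equality of slices carries the
bound to `u t` (the Hardy integral does not see null sets), on every ball.
-/

noncomputable section

-- Problem = summit for this single-conjunct summit: the duplicate namespace component is deliberate.
set_option linter.dupNamespace false

namespace Summit.NavierStokesRegularity.NavierStokesRegularity.Theorems.PlanarEnergyAPriori

open MeasureTheory Set Filter Topology WithLp Real Metric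
open scoped ENNReal NNReal
open Literature.Analysis.FluidPDE

/-- **Global Hardy ceiling of a Kato solution under the planar crux.** Under `PlanarEnergyAPriori`,
every Kato solution `u` on `[0, T)` from a smooth divergence-free rapidly decaying datum has
`∫ |u(t)|²/|x − x₀| ≤ 2πM` for all `t ∈ [0, T)` and all centres `x₀`, where `M` is the planar
ceiling of its classical Leray–Hopf representative. -/
theorem hardy_le_of_planarEnergyAPriori_of_isKatoSolutionOn
    (hP : Summit.NavierStokesRegularity.NavierStokesRegularity.Theses.PlaneEnergyCeiling.PlanarEnergyAPriori)
    {ν : ℝ} (hν : 0 < ν) {u₀ : EuclideanSpace ℝ (Fin 3) → EuclideanSpace ℝ (Fin 3)}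
    (hsm : ContDiff ℝ (⊤ : ℕ∞) u₀) (hdiv : Literature.Analysis.FluidPDE.NSWave0.IsDivFree u₀)
    (hdec : HasRapidSpatialDecay u₀) {T : ℝ} (hT : 0 < T)
    {u : ℝ → EuclideanSpace ℝ (Fin 3) → EuclideanSpace ℝ (Fin 3)} (hu : IsKatoSolutionOn T ν u₀ u) :
    ∃ M : ℝ, ∀ t ∈ Ico 0 T, ∀ x₀ : EuclideanSpace ℝ (Fin 3),
      ∫⁻ x, ‖u t x‖ₑ ^ 2 / ‖x - x₀‖ₑ ≤ ENNReal.ofReal (2 * π) * ENNReal.ofReal M := by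
  obtain ⟨U, P, hcl, hLH, hU0, hae⟩ := exists_frame_of_isKatoSolutionOn hν hsm hdiv hdec hT hu
  have hLH' : IsLerayHopfOn T ν 0 (U 0) U := by rw [hU0]; exact hLH
  have hdec' : HasRapidSpatialDecay (U 0) := by rw [hU0]; exact hdec
  obtain ⟨M, hM⟩ := hP ν T hν hT U P hcl hLH' hdec'
  refine ⟨M, fun t ht x₀ => ?_⟩
  have hmeas : Measurable fun x : EuclideanSpace ℝ (Fin 3) => ‖U t x‖ₑ ^ 2 :=
    ((hcl.contDiff_velocity ht).continuous.measurable.enorm).pow_const 2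
  have key : ∫⁻ x, ‖U t x‖ₑ ^ 2 / ‖x - x₀‖ₑ ≤ ENNReal.ofReal (2 * π) * ENNReal.ofReal M :=
    lintegral_div_enorm_sub_le_of_planar (g := fun x => ‖U t x‖ₑ ^ 2) hmeas
      (fun R c => hM t ht R c) x₀
  calc ∫⁻ x, ‖u t x‖ₑ ^ 2 / ‖x - x₀‖ₑ = ∫⁻ x, ‖U t x‖ₑ ^ 2 / ‖x - x₀‖ₑ :=
        lintegral_congr_ae ((hae t ht).mono fun x hx => by simp only [hx])
    _ ≤ ENNReal.ofReal (2 * π) * ENNReal.ofReal M := key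

/-- **Registered anchor `hardyEnergyBound_of_planarEnergyAPriori`: the planar-energy ceiling crux
implies the Hardy-energy crux C2 of route HardyPointSink** (`r₀ = 1`, `K = 2πM`). -/
theorem hardyEnergyBound_of_planarEnergyAPriori :
    Summit.NavierStokesRegularity.NavierStokesRegularity.Theses.PlaneEnergyCeiling.PlanarEnergyAPriori →
    Summit.NavierStokesRegularity.NavierStokesRegularity.Theses.HardyPointSink.HardyEnergyBound := by
  intro hP ν hν u₀ hsm hdiv hdec T u hT hu xs
  obtain ⟨M, hM⟩ := hardy_le_of_planarEnergyAPriori_of_isKatoSolutionOn hP hν hsm hdiv hdec hT hu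
  have hfin : ENNReal.ofReal (2 * π) * ENNReal.ofReal M ≠ ∞ :=
    ENNReal.mul_ne_top ENNReal.ofReal_ne_top ENNReal.ofReal_ne_top
  refine ⟨1, one_pos, (ENNReal.ofReal (2 * π) * ENNReal.ofReal M).toNNReal, ?_⟩
  intro x₀ _ t ht _
  calc ∫⁻ x in ball xs 1, ‖u t x‖ₑ ^ 2 / ‖x - x₀‖ₑ ≤ ∫⁻ x, ‖u t x‖ₑ ^ 2 / ‖x - x₀‖ₑ :=
        setLIntegral_le_lintegral _ _
    _ ≤ ENNReal.ofReal (2 * π) * ENNReal.ofReal M := hM t ht x₀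
    _ = ((ENNReal.ofReal (2 * π) * ENNReal.ofReal M).toNNReal : ℝ≥0∞) :=
        (ENNReal.coe_toNNReal hfin).symm

end Summit.NavierStokesRegularity.NavierStokesRegularity.Theorems.PlanarEnergyAPriori

end
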